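import Mathlib
import Summits.ValiantsHypothesis.ValiantsHypothesis.Theorems.BarrierLeverDefinableEquationsPartialDerivativeWallAllOrdersPrelims

/-!
# Route BarrierLever — method wall #1c, part 2: the shifted partials of EVERY FIXED ORDER `k`
# AND SHIFT `τ` of `W_{k,e} = Σ_{j<k} (Σ_i x_i^{e+j+1})^k` attain the universal ceiling
# (crux `DefinableEquations` stmt-8745 / item `SingleSizeEquations` stmt-8749; val-np-p5 g13)

**Theorem (`shiftedPartialsRank_powerSumPowers_eq`).**  Over a field `K` of characteristic `0`,
for every order `k ≥ 1`, shift `τ` and `e ≥ τ + k`, the polynomial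
`W_{k,e} = Σ_{j<k} (Σ_i x_i^{e+j+1})^k ∈ K[x_1..x_n]` has
`rank (W_{k,e})_{(k,·)[τ]} = #{γ : deg γ = k} · #{β : deg β = τ} = C(n+k-1,k) · C(n+τ-1,τ)`,
the number of pairs (order-`k` operator, degree-`τ` shift monomial) — the universal ceiling of
the measure (part 1, `shiftedPartialsRank_le_card_mul_card`); hence
`rank g_{(k,·)[τ]} ≤ rank (W_{k,e})_{(k,·)[τ]}` for EVERY polynomial `g` in `n` variables
(`shiftedPartialsRank_le_powerSumPowers`).  `k = 1` is g11's Fermat row (one power sum),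
`(k, 0)` for `k ≤ √n` re-proves part of g10's shift-zero wall with a different witness; every
cell with `τ ≥ 1`, `k ≥ 2` is new in the kernel (the census of g11/g12 had them saturated only
numerically, `n ≤ 10`).

**Proof** (`linearIndependent_gen_powerSumPowers`).  Let `P = (Σ_i x_i)^k = Σ_{|c|=k} M(c) x^c`
(`M(c) > 0` multinomial) and suppose `Σ_{γ,β} λ_{γβ} x^β ∂^γ W = 0`.  Fix a generator
`(γ*, β*)` and a level `E = e + j + 1` (`j < k`), and read off the coefficient of the monomial
`x^{(E-1)•γ* + β*}`.  A generator `x^β ∂^γ` applied to the level-`E'` piece `P(x^{E'})` produces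
the monomials `x^{β + E'•c - γ}` (`|c| = k`, `γ ≤ E'•c`) with coefficient `M(c) · Π_{E'}(c, γ)`,
`Π_{E'}(c,γ) = ∏_i (c_i E')_{γ_i}` (falling factorials).  DECODING (§1, `decode`): since
`0 ≤ β_i ≤ τ`, `0 ≤ γ_i ≤ k` and `E, E' ≥ τ + k + 1`, the equation
`β + E'•c - γ = (E-1)•γ* + β*` forces `E' = E` (degrees), `c = γ*` (coordinatewise, the
multiples of the level dominate) and `β - γ = β* - γ*` (the generator lies in the BLOCK of
`(γ*, β*)`).  So the coefficient is `M(γ*) · Σ_{(γ,β) in the block} λ_{γβ} Π_E(γ*, γ) = 0`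
(§2, `coeff_gen_powerSumPowers`).  THE FORMAL LEVEL (§3): `Q(Y) := Σ_{block} λ_{γβ} Q_γ(Y)` with
`Q_γ(Y) = ∏_i ∏_{t<γ_i} (γ*_i Y - t)` is a univariate polynomial of degree `≤ k` with
`Q(E) = Σ_{block} λ_{γβ} Π_E(γ*,γ) = 0` at the `k` levels `E = e+1, …, e+k` AND `Q(0) = 0`
(every `γ ≠ 0`): `k + 1` roots, so `Q ≡ 0`, so `Q(1) = Σ_{block} λ_{γβ} ∏_i (γ*_i)_{γ_i} = 0`.
But `(γ*_i)_{γ_i} = 0` as soon as `γ_i > γ*_i`, which happens for every `γ ≠ γ*` of the same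
degree; and `γ = γ*` in the block forces `β = β*`.  Hence `λ_{γ*β*} · ∏_i γ*_i! = 0`. ∎
(The `k` levels are what make the falling-factorial block matrices — dense on each support
class for a single level — collapse to a diagonal; numerically a single level `(Σ x_i^e)^k`
already saturates every cell with `τ ≤ e - 2`, exact mod `p`, `(k,τ,n)` up to `(4,1,12)`.)

Honest scope.  A METHOD WALL one file away (part 3 puts `W_{k,e}` inside `SmallCircuits ℂ n 2`
with `O(k n log n)` gates): the crux / item are untouched (b = 2 OPEN, Chatterjee–Tengse
arXiv:2309.07612 §1.3 dir. 2); nothing bears on `VP ≠ VNP`; the regime where `k` or `τ` grows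
with `n` (`k(τ+2k) > n`, Gupta–Kamath–Kayal–Saptharishi) is NOT covered.  No definitions, no
named facts; standard axioms.  Refs: Landsberg 2017 §6.2.2; Gesmundo–Landsberg 2019 Thm. 4 / §1
(saturation by cheap polynomials, the `τ = 0` prototype); Forbes–Shpilka–Volk 2018 Cor. 5.
-/

-- `Summit.ValiantsHypothesis.ValiantsHypothesis.…` repeats a component by the D-0017 layout
-- (single-conjunct summit), which the `dupNamespace` linter flags; the name is mandated.
set_option linter.dupNamespace false

noncomputable section

namespace Summit.ValiantsHypothesis.ValiantsHypothesis.Theorems.BarrierLeverDefinableEquations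

open MvPolynomial
open Literature.Computability.AlgebraicComplexity
open Literature.Barriers.ValiantsHypothesis
open scoped BigOperators

namespace PartialDerivativeWall

section Decode

variable {K : Type*} [Field K] {n : ℕ}

/-! ## §1 Decoding: the monomial `x^{E₁•γ* + β*}` pins down the level, the column and the block -/

/-- **Decoding lemma.**  If `deg β = deg β* = τ`, `deg γ = deg γ* = deg c = k ≥ 1`, the levels
satisfy `E₁ ≥ τ + k`, `E' ≥ τ + k + 1`, `γ ≤ E'•c` and `x^β · x^{E'•c - γ} = x^{E₁•γ* + β*}`, then
`E' = E₁ + 1`, `c = γ*` and `β + γ* = β* + γ` (the generator `(γ, β)` lies in the block of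
`(γ*, β*)`). [folklore] -/
theorem decode {k τ E₁ E' : ℕ} {β βs γ γs c : Fin n →₀ ℕ} (hk : 1 ≤ k) (hE : τ + k ≤ E₁)
    (hE' : τ + k + 1 ≤ E') (hβ : β.degree = τ) (hβs : βs.degree = τ) (hγ : γ.degree = k)
    (hγs : γs.degree = k) (hc : c.degree = k) (hle : γ ≤ E' • c)
    (heq : β + (E' • c - γ) = E₁ • γs + βs) :
    E' = E₁ + 1 ∧ c = γs ∧ β + γs = βs + γ := by
  have h1 : β + E' • c = E₁ • γs + βs + γ := by
    rw [← heq, add_assoc, tsub_add_cancel_of_le hle]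
  -- degrees: `τ + E' k = E₁ k + τ + k`
  have hdeg := congrArg Finsupp.degree h1
  simp only [map_add, map_nsmul, smul_eq_mul, hβ, hβs, hγ, hγs, hc] at hdeg
  have hEE : E' = E₁ + 1 := by
    apply Nat.eq_of_mul_eq_mul_right hk
    rw [Nat.succ_mul]
    omega
  subst hEE
  -- coordinates
  have hcoord : ∀ i, β i + (E₁ * c i + c i) = E₁ * γs i + βs i + γ i := by
    intro i
    have := congrArg (fun f : Fin n →₀ ℕ => f i) h1
    simpa [Finsupp.add_apply, Finsupp.smul_apply, Nat.succ_mul] using this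
  have hcγ : c = γs := by
    ext i
    have h := hcoord i
    have hβi := apply_le_of_degree_eq hβ i
    have hβsi := apply_le_of_degree_eq hβs i
    have hγi := apply_le_of_degree_eq hγ i
    have hγsi := apply_le_of_degree_eq hγs i
    have hci := apply_le_of_degree_eq hc i
    rcases Nat.lt_trichotomy (c i) (γs i) with hlt | heq' | hgt
    · exfalso
      have hm : E₁ * c i + E₁ ≤ E₁ * γs i := by
        have := Nat.mul_le_mul_left E₁ (Nat.succ_le_of_lt hlt)
        rwa [Nat.mul_succ] at this
      omega
    · exact heq'
    · exfalso
      have hm : E₁ * γs i + E₁ ≤ E₁ * c i := by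
        have := Nat.mul_le_mul_left E₁ (Nat.succ_le_of_lt hgt)
        rwa [Nat.mul_succ] at this
      omega
  subst hcγ
  refine ⟨rfl, rfl, ?_⟩
  ext i
  have h := hcoord i
  simp only [Finsupp.add_apply]
  omega
end Decode

/-! ## §2 The coefficient of `x^{E₁•γ* + β*}` in a generator of `W` -/

section Coeff

variable {K : Type*} [Field K] {n : ℕ} [CharZero K] {k τ e : ℕ}


/-- **Coefficient of the decoding monomial at one level.**  For `E₁ ≥ τ + k`, a level
`E' ≥ τ + k + 1`, `deg γ = deg γ* = k ≥ 1`, `deg β = deg β* = τ`: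
`coeff_{x^{E₁•γ* + β*}} (x^β ∂^γ P(x^{E'})) = [E' = E₁ + 1 ∧ β + γ* = β* + γ] · coeff_{γ*}(P) · Π_{E'}(γ*, γ)`
for the base form `P = (Σ x_i)^k`. [folklore] -/
theorem coeff_gen_expand {E₁ E' : ℕ} {β βs γ γs : Fin n →₀ ℕ} (hk : 1 ≤ k) (hE : τ + k ≤ E₁)
    (hE' : τ + k + 1 ≤ E') (hβ : β.degree = τ) (hβs : βs.degree = τ) (hγ : γ.degree = k)
    (hγs : γs.degree = k) :
    coeff (E₁ • γs + βs) (monomial β (1 : K) * iterPDeriv (dirList γ) (expand E' (linPow K n k))) =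
      if E' = E₁ + 1 ∧ β + γs = βs + γ then
        coeff γs (linPow K n k) * ffWeight K E' γs γ else 0 := by
  classical
  rw [gen_expand_eq_sum, coeff_sum]
  simp_rw [coeff_monomial]
  have hkey : ∀ c ∈ (linPow K n k).support,
      (if β + (E' • c - γ) = E₁ • γs + βs then coeff c (linPow K n k) * ffWeight K E' c γ else 0) =
        if E' = E₁ + 1 ∧ β + γs = βs + γ then
          (if c = γs then coeff c (linPow K n k) * ffWeight K E' c γ else 0) else 0 := by
    intro c hc
    by_cases hw : ffWeight K E' c γ = 0
    · simp [hw]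
    have hle := le_smul_of_ffWeight_ne_zero hw
    have hcd := degree_eq_of_mem_support_linPow hc
    by_cases hθ : β + (E' • c - γ) = E₁ • γs + βs
    · obtain ⟨hEE, hcc, hbl⟩ := decode hk hE hE' hβ hβs hγ hγs hcd hle hθ
      rw [if_pos hθ, if_pos ⟨hEE, hbl⟩, if_pos hcc]
    · rw [if_neg hθ]
      by_cases hcond : E' = E₁ + 1 ∧ β + γs = βs + γ
      · rw [if_pos hcond]
        by_cases hcc : c = γs
        · exfalso
          apply hθ
          subst hcc
          obtain ⟨hEE, hbl⟩ := hcond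
          subst hEE
          have h2 : β + (((E₁ + 1) • c - γ) + γ) = (E₁ • c + βs) + γ := by
            rw [tsub_add_cancel_of_le hle, succ_nsmul, ← add_assoc, add_comm β, add_assoc, hbl,
              ← add_assoc]
          rw [← add_assoc] at h2
          exact add_right_cancel h2
        · rw [if_neg hcc]
      · rw [if_neg hcond]
  rw [Finset.sum_congr rfl hkey]
  by_cases hcond : E' = E₁ + 1 ∧ β + γs = βs + γ
  · simp_rw [if_pos hcond]
    rw [Finset.sum_ite_eq' (linPow K n k).support γs, if_pos]
    exact mem_support_iff.mpr (coeff_linPow_ne_zero hγs)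
  · simp_rw [if_neg hcond]
    rw [Finset.sum_const_zero]

/-- **Coefficient of the decoding monomial in a generator of the witness.**  With `E₁ = e + j₀`
(`j₀ < k`) one of the `k` levels: `coeff_{x^{E₁•γ* + β*}} (x^β ∂^γ W_{k,e}) =
[β + γ* = β* + γ] · coeff_{γ*}(P) · Π_{E₁+1}(γ*, γ)`. [folklore] -/
theorem coeff_gen_powerSumPowers (hk : 1 ≤ k) (he : τ + k ≤ e) (j₀ : Fin k)
    {β βs γ γs : Fin n →₀ ℕ} (hβ : β.degree = τ) (hβs : βs.degree = τ) (hγ : γ.degree = k)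
    (hγs : γs.degree = k) :
    coeff ((e + j₀) • γs + βs)
        (monomial β (1 : K) * iterPDeriv (dirList γ) (powerSumPowers K n k e)) =
      if β + γs = βs + γ then
        coeff γs (linPow K n k) * ffWeight K (e + j₀ + 1) γs γ else 0 := by
  classical
  unfold powerSumPowers
  rw [iterPDeriv_sum, Finset.mul_sum, coeff_sum]
  have hterm : ∀ j : Fin k,
      coeff ((e + j₀) • γs + βs)
          (monomial β (1 : K) * iterPDeriv (dirList γ) (expand (e + j + 1) (linPow K n k))) =
        if j = j₀ then (if β + γs = βs + γ then
          coeff γs (linPow K n k) * ffWeight K (e + j₀ + 1) γs γ else 0) else 0 := by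
    intro j
    rw [coeff_gen_expand hk (by omega) (by omega) hβ hβs hγ hγs]
    by_cases hj : j = j₀
    · subst hj
      simp
    · have hne : ¬ (e + (j : ℕ) + 1 = e + j₀ + 1 ∧ β + γs = βs + γ) := by
        rintro ⟨h, -⟩
        exact hj (Fin.ext (by omega))
      rw [if_neg hne, if_neg hj]
  simp_rw [hterm]
  rw [Finset.sum_ite_eq' Finset.univ j₀, if_pos (Finset.mem_univ _)]

end Coeff

/-! ## §3 The formal level: a polynomial of degree `≤ k` with `k + 1` roots -/

section Independence

variable {K : Type*} [Field K] {n : ℕ} [CharZero K] {k τ e : ℕ}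

/-- **Linear independence of the generators of the witness.**  For `k ≥ 1` and `e ≥ τ + k`
(levels `e+1, …, e+k ≥ τ + k + 1`), the `#{deg-k γ} · #{deg-τ β}` generators `x^β ∂^γ W_{k,e}`
are linearly independent.  Proof: the coefficient of `x^{(e+j)•γ* + β*}` in a relation
`Σ λ_{γβ} x^β ∂^γ W = 0` is `coeff_{γ*}(P) · Q(e+j+1)` with `Q = Σ_{block} λ_{γβ} Q_γ` of degree
`≤ k`; `Q` vanishes at `0, e+1, …, e+k`, hence identically, and `Q(1) = λ_{γ*β*} ∏ γ*_i!`.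
[folklore] -/
theorem linearIndependent_gen_powerSumPowers (hk : 1 ≤ k) (he : τ + k ≤ e) :
    LinearIndependent K (gen k τ (powerSumPowers K n k e)) := by
  classical
  rw [Fintype.linearIndependent_iff]
  intro lam hsum p₀
  obtain ⟨⟨γs, hγs'⟩, ⟨βs, hβs'⟩⟩ := p₀
  have hγs : γs.degree = k := (degree_eq_iff_mem_finsuppAntidiag γs k).mpr hγs'
  have hβs : βs.degree = τ := (degree_eq_iff_mem_finsuppAntidiag βs τ).mpr hβs'
  -- abbreviations
  have hdegγ : ∀ p : GenIdx n k τ, (p.1 : Fin n →₀ ℕ).degree = k :=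
    fun p => (degree_eq_iff_mem_finsuppAntidiag _ k).mpr p.1.2
  have hdegβ : ∀ p : GenIdx n k τ, (p.2 : Fin n →₀ ℕ).degree = τ :=
    fun p => (degree_eq_iff_mem_finsuppAntidiag _ τ).mpr p.2.2
  have hP0 : coeff γs (linPow K n k) ≠ 0 := coeff_linPow_ne_zero hγs
  -- the polynomial in the formal level
  set Q : Polynomial K := ∑ p : GenIdx n k τ,
      if (p.2 : Fin n →₀ ℕ) + γs = βs + (p.1 : Fin n →₀ ℕ) then
        lam p • rowPoly K γs (p.1 : Fin n →₀ ℕ) else 0 with hQ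
  have hQeval : ∀ E : ℕ, Q.eval (E : K) = ∑ p : GenIdx n k τ,
      if (p.2 : Fin n →₀ ℕ) + γs = βs + (p.1 : Fin n →₀ ℕ) then
        lam p * ffWeight K E γs (p.1 : Fin n →₀ ℕ) else 0 := by
    intro E
    rw [hQ, Polynomial.eval_finsetSum]
    refine Finset.sum_congr rfl fun p _ => ?_
    split_ifs with h
    · rw [Polynomial.eval_smul, eval_rowPoly_natCast, smul_eq_mul]
    · rw [Polynomial.eval_zero]
  -- (1) the levels are roots
  have hlev : ∀ j : Fin k, Q.eval ((e + j + 1 : ℕ) : K) = 0 := by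
    intro j
    rw [hQeval]
    have hc := congrArg (coeff ((e + (j : ℕ)) • γs + βs)) hsum
    rw [coeff_sum, coeff_zero] at hc
    have hc' : ∑ p : GenIdx n k τ, lam p * (if (p.2 : Fin n →₀ ℕ) + γs = βs + (p.1 : Fin n →₀ ℕ) then
        coeff γs (linPow K n k) * ffWeight K (e + j + 1) γs (p.1 : Fin n →₀ ℕ) else 0) = 0 := by
      refine Eq.trans (Finset.sum_congr rfl fun p _ => ?_) hc
      rw [coeff_smul, smul_eq_mul, gen, coeff_gen_powerSumPowers hk he j (hdegβ p) hβs (hdegγ p) hγs]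
    have hfac : ∑ p : GenIdx n k τ, lam p * (if (p.2 : Fin n →₀ ℕ) + γs = βs + (p.1 : Fin n →₀ ℕ) then
        coeff γs (linPow K n k) * ffWeight K (e + j + 1) γs (p.1 : Fin n →₀ ℕ) else 0) =
        coeff γs (linPow K n k) * ∑ p : GenIdx n k τ,
          (if (p.2 : Fin n →₀ ℕ) + γs = βs + (p.1 : Fin n →₀ ℕ) then
            lam p * ffWeight K (e + j + 1) γs (p.1 : Fin n →₀ ℕ) else 0) := by
      rw [Finset.mul_sum]
      refine Finset.sum_congr rfl fun p _ => ?_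
      split_ifs <;> ring
    rw [hfac] at hc'
    exact (mul_eq_zero.mp hc').resolve_left hP0
  -- (2) zero is a root
  have hzero : Q.eval 0 = 0 := by
    rw [hQ, Polynomial.eval_finsetSum]
    refine Finset.sum_eq_zero fun p _ => ?_
    split_ifs with h
    · have hne : (p.1 : Fin n →₀ ℕ) ≠ 0 := by
        intro h0
        have := hdegγ p
        rw [h0, map_zero] at this
        omega
      rw [Polynomial.eval_smul, eval_rowPoly_zero hne, smul_zero]
    · rw [Polynomial.eval_zero]
  -- (3) degree ≤ k, so Q = 0
  have hdeg : Q.natDegree ≤ k := by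
    rw [hQ]
    refine Polynomial.natDegree_sum_le_of_forall_le _ _ fun p _ => ?_
    split_ifs with h
    · exact (Polynomial.natDegree_smul_le _ _).trans ((natDegree_rowPoly_le _ _).trans (hdegγ p).le)
    · simp
  have hQ0 : Q = 0 := by
    refine Polynomial.eq_zero_of_natDegree_lt_card_of_eval_eq_zero Q
      (f := fun o : Option (Fin k) => o.elim (0 : K) (fun j => ((e + j + 1 : ℕ) : K))) ?_ ?_ ?_
    · intro o o' hoo
      cases o with
      | none =>
        cases o' with
        | none => rfl
        | some j' =>
          exfalso
          simp only [Option.elim] at hoo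
          have h0 : ((e + j' + 1 : ℕ) : K) = ((0 : ℕ) : K) := by rw [Nat.cast_zero]; exact hoo.symm
          exact absurd (Nat.cast_injective h0) (by omega)
      | some j =>
        cases o' with
        | none =>
          exfalso
          simp only [Option.elim] at hoo
          have h0 : ((e + j + 1 : ℕ) : K) = ((0 : ℕ) : K) := by rw [Nat.cast_zero]; exact hoo
          exact absurd (Nat.cast_injective h0) (by omega)
        | some j' =>
          simp only [Option.elim] at hoo
          have h' : (e + j + 1 : ℕ) = e + j' + 1 := by exact_mod_cast hoo
          congr 1
          exact Fin.ext (by omega)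
    · intro o
      cases o with
      | none => exact hzero
      | some j => exact hlev j
    · rw [Fintype.card_option, Fintype.card_fin]
      omega
  -- (4) evaluate at 1
  have hone : Q.eval 1 = 0 := by rw [hQ0, Polynomial.eval_zero]
  rw [hQ, Polynomial.eval_finsetSum] at hone
  rw [Finset.sum_eq_single (⟨⟨γs, hγs'⟩, ⟨βs, hβs'⟩⟩ : GenIdx n k τ)] at hone
  · have hbl : βs + γs = βs + γs := rfl
    rw [if_pos hbl, Polynomial.eval_smul, eval_rowPoly_one, smul_eq_mul] at hone
    refine (mul_eq_zero.mp hone).resolve_right ?_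
    refine Finset.prod_ne_zero_iff.mpr fun i _ => ?_
    change ((γs i).descFactorial (γs i) : K) ≠ 0
    rw [Nat.descFactorial_self]
    exact_mod_cast (Nat.factorial_ne_zero _)
  · -- other generators of the block have `γ ≠ γ*`, and then `Q_γ(1) = 0`
    rintro ⟨⟨γ, hγ'⟩, ⟨β, hβ'⟩⟩ _ hne
    split_ifs with hbl
    · have hγ : γ.degree = k := (degree_eq_iff_mem_finsuppAntidiag γ k).mpr hγ'
      have hγne : γ ≠ γs := by
        intro hγγ
        apply hne
        subst hγγ
        have hββ : β = βs := add_right_cancel hbl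
        subst hββ
        rfl
      obtain ⟨i, hi⟩ := exists_apply_lt_of_ne (hγ.trans hγs.symm) hγne
      rw [Polynomial.eval_smul, eval_rowPoly_one, Finset.prod_eq_zero (Finset.mem_univ i), smul_zero]
      exact_mod_cast Nat.descFactorial_eq_zero_iff_lt.mpr hi
    · rw [Polynomial.eval_zero]
  · intro h; exact absurd (Finset.mem_univ _) h

/-- **The witness attains the universal ceiling**: for `k ≥ 1`, `e ≥ τ + k`,
`rank (W_{k,e})_{(k,·)[τ]} = #{deg-k γ} · #{deg-τ β}` (`= C(n+k-1,k)·C(n+τ-1,τ)`).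
[cite: LandsbergGCT2017, §6.2.2 (p. 158)] -/
theorem shiftedPartialsRank_powerSumPowers_eq (hk : 1 ≤ k) (he : τ + k ≤ e) :
    shiftedPartialsRank K k τ (powerSumPowers K n k e) =
      ((Finset.univ : Finset (Fin n)).finsuppAntidiag k).card *
        ((Finset.univ : Finset (Fin n)).finsuppAntidiag τ).card :=
  shiftedPartialsRank_eq_of_linearIndependent (linearIndependent_gen_powerSumPowers hk he)

/-- **Saturation at every fixed order and shift**: `rank g_{(k,·)[τ]} ≤ rank (W_{k,e})_{(k,·)[τ]}`
for EVERY `g ∈ K[x_1..x_n]` (any degree, homogeneous or not), `k ≥ 1`, `e ≥ τ + k`.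
[cite: GesmundoLandsberg2017, Thm. 4 and §1] -/
theorem shiftedPartialsRank_le_powerSumPowers (hk : 1 ≤ k) (he : τ + k ≤ e)
    (g : MvPolynomial (Fin n) K) :
    shiftedPartialsRank K k τ g ≤ shiftedPartialsRank K k τ (powerSumPowers K n k e) := by
  rw [shiftedPartialsRank_powerSumPowers_eq hk he]
  exact shiftedPartialsRank_le_card_mul_card k τ g

end Independence

end PartialDerivativeWall

end Summit.ValiantsHypothesis.ValiantsHypothesis.Theorems.BarrierLeverDefinableEquations
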